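import Literature.Analysis.Complex.SymmetricRiemannMap
import Summits.CriticalPhenomena.CardyFormulaZ2.Theorems.CardyAnchoredRigidityStretchedPullbackNotTargetBlindRectangles

/-!
# The radial stretch `z ↦ b + (z - b)|z - b|^α` about a real point

Helper file for route CardyAnchoredRigidity, item stmt-CriticalPhenomena-14488
(`StretchedPullbackNotTargetBlind`).

Elementary properties of a plane homeomorphism `Φ` acting as the radial stretch (`∀ z, Φ z = stretchFn b α z`)
`F_{b}(z) = b + (z - b)|z - b|^α` about a REAL centre `b` (`α > 0`): it preserves the real axis, the
upper half-plane and complex conjugation, `|Φ z - b| = |z - b|^{1+α}`, and explicit formulas on the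
real axis. The image `Φ '' bigRect` of the test rectangle is an open, connected, simply connected
subset of `ℍ` containing the half-disc `B(1, 8) ∩ ℍ` when `b ∈ {0, 1}` — the hypotheses of the
symmetric chart (`exists_symmetricChart`). Elementary; no named facts.
-/

noncomputable section

open Set Metric Complex Filter Topology
open scoped ComplexConjugate
open UpperHalfPlane (upperHalfPlaneSet isOpen_upperHalfPlaneSet)

namespace Summit.CriticalPhenomena.CardyFormulaZ2.Theorems.StretchedPullback

open Literature.Probability.RandomPlanarGeometry

/-- The radial stretch of exponent `α` about the real point `b`, as a formula:
`F_b z = b + (z - b)|z - b|^α`. -/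
def stretchFn (b α : ℝ) (z : ℂ) : ℂ := b + (z - b) * ((‖z - (b : ℂ)‖ ^ α : ℝ) : ℂ)

namespace Stretch

variable {Φ : ℂ ≃ₜ ℂ} {b α : ℝ} (h : ∀ z : ℂ, Φ z = stretchFn b α z)
include h

/-- `Φ z - b = (z - b) |z - b|^α`. -/
theorem sub_eq (z : ℂ) : Φ z - b = (z - b) * ((‖z - (b : ℂ)‖ ^ α : ℝ) : ℂ) := by
  rw [h z, stretchFn]; ring

/-- The centre is fixed. -/
theorem apply_center : Φ b = b := by
  rw [h b, stretchFn]; simp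

/-- Imaginary part: `Im Φ z = Im z · |z - b|^α`. -/
theorem im_apply (z : ℂ) : (Φ z).im = z.im * ‖z - (b : ℂ)‖ ^ α := by
  rw [h z, stretchFn, add_im, ofReal_im, zero_add, mul_im, ofReal_re, ofReal_im, mul_zero, zero_add, sub_im,
    ofReal_im, sub_zero]

/-- `Φ` preserves the upper half-plane, in both directions. -/
theorem mem_upperHalfPlaneSet_iff (z : ℂ) :
    Φ z ∈ upperHalfPlaneSet ↔ z ∈ upperHalfPlaneSet := by
  show 0 < (Φ z).im ↔ 0 < z.im
  rw [im_apply h]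
  constructor
  · intro hpos
    exact pos_of_mul_pos_left hpos (Real.rpow_nonneg (norm_nonneg _) α)
  · intro hpos
    have hne : z - (b : ℂ) ≠ 0 := by
      intro h0
      have : z.im = 0 := by
        have := congrArg Complex.im h0
        simpa using this
      exact hpos.ne' this
    exact mul_pos hpos (Real.rpow_pos_of_pos (norm_pos_iff.2 hne) α)

/-- `Φ` commutes with complex conjugation. -/
theorem apply_conj (z : ℂ) : Φ (conj z) = conj (Φ z) := by
  rw [h z, h (conj z), stretchFn, stretchFn]
  have hn : ‖conj z - (b : ℂ)‖ = ‖z - (b : ℂ)‖ := by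
    rw [← conj_ofReal b, ← map_sub, norm_conj, conj_ofReal]
  rw [hn]
  simp [map_add, map_mul, conj_ofReal]

/-- `|Φ z - b| = |z - b|^{1+α}`. -/
theorem norm_sub (hα : 0 ≤ α) (z : ℂ) : ‖Φ z - b‖ = ‖z - (b : ℂ)‖ ^ (1 + α) := by
  rw [sub_eq h, norm_mul, norm_real, Real.norm_eq_abs,
    abs_of_nonneg (Real.rpow_nonneg (norm_nonneg _) α),
    Real.rpow_add' (norm_nonneg _) (by linarith : (1 : ℝ) + α ≠ 0), Real.rpow_one]

/-- On the real axis: `Φ t = b + (t - b)|t - b|^α`, a real number. -/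
theorem apply_ofReal (t : ℝ) : Φ (t : ℂ) = ((b + (t - b) * |t - b| ^ α : ℝ) : ℂ) := by
  rw [h t, stretchFn, ← ofReal_sub, norm_real, Real.norm_eq_abs]
  push_cast
  ring

/-- On the real axis to the right of the centre: `Φ t = b + (t - b)^{1+α}`. -/
theorem apply_ofReal_of_le (hα : 0 ≤ α) {t : ℝ} (ht : b ≤ t) :
    Φ (t : ℂ) = ((b + (t - b) ^ (1 + α) : ℝ) : ℂ) := by
  rw [apply_ofReal h, abs_of_nonneg (sub_nonneg.2 ht),
    Real.rpow_add' (sub_nonneg.2 ht) (by linarith : (1 : ℝ) + α ≠ 0), Real.rpow_one]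

/-- On the real axis to the left of the centre: `Φ t = b - (b - t)^{1+α}`. -/
theorem apply_ofReal_of_ge (hα : 0 ≤ α) {t : ℝ} (ht : t ≤ b) :
    Φ (t : ℂ) = ((b - (b - t) ^ (1 + α) : ℝ) : ℂ) := by
  rw [apply_ofReal h, abs_of_nonpos (sub_nonpos.2 ht), neg_sub,
    Real.rpow_add' (sub_nonneg.2 ht) (by linarith : (1 : ℝ) + α ≠ 0), Real.rpow_one]
  push_cast
  ring

/-- The real trace `t ↦ Φ t` as a real function. -/
theorem re_apply_ofReal (t : ℝ) : (Φ (t : ℂ)).re = b + (t - b) * |t - b| ^ α := by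
  rw [apply_ofReal h, ofReal_re]

/-- The real trace is strictly increasing (for `α ≥ 0`). -/
theorem strictMono_re (hα : 0 ≤ α) : StrictMono fun t : ℝ => (Φ (t : ℂ)).re := by
  -- `t ↦ (t - b)|t - b|^α` is strictly increasing: odd, and increasing on `t ≥ b`
  have key : ∀ s t : ℝ, s < t → (s - b) * |s - b| ^ α < (t - b) * |t - b| ^ α := by
    intro s t hst
    have mono : ∀ u v : ℝ, 0 ≤ u → u < v → u * |u| ^ α < v * |v| ^ α := by
      intro u v hu huv
      rw [abs_of_nonneg hu, abs_of_nonneg (hu.trans huv.le)]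
      have hv : 0 < v := hu.trans_lt huv
      rcases eq_or_lt_of_le hu with rfl | hu'
      · rw [zero_mul]; exact mul_pos hv (Real.rpow_pos_of_pos hv α)
      · exact mul_lt_mul huv (Real.rpow_le_rpow hu huv.le hα) (Real.rpow_pos_of_pos hu' α) hv.le
    rcases le_or_gt 0 (s - b) with hs | hs
    · exact mono _ _ hs (by linarith)
    · rcases le_or_gt 0 (t - b) with ht | ht
      · -- `s - b < 0 ≤ t - b`
        have h1 : (s - b) * |s - b| ^ α < 0 := mul_neg_of_neg_of_pos hs (Real.rpow_pos_of_pos (abs_pos.2 hs.ne) α)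
        have h2 : 0 ≤ (t - b) * |t - b| ^ α := mul_nonneg ht (Real.rpow_nonneg (abs_nonneg _) α)
        linarith
      · -- both negative: use oddness
        have := mono (-(t - b)) (-(s - b)) (by linarith) (by linarith)
        rw [abs_neg, abs_neg] at this
        linarith
  intro s t hst
  simp only [re_apply_ofReal h]
  linarith [key s t hst]

/-- `Φ` maps `(b - 2, b + 2)` into `(b - 4, b + 4)` when `0 ≤ α ≤ 1` (`|t - b|^{1+α} < 4`). -/
theorem abs_re_sub_lt (hα : 0 ≤ α) (hα1 : α ≤ 1) {t : ℝ} (ht : |t - b| < 2) : |(Φ (t : ℂ)).re - b| < 4 := by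
  rw [re_apply_ofReal h, add_sub_cancel_left, abs_mul, abs_of_nonneg (Real.rpow_nonneg (abs_nonneg _) α)]
  have h0 : 0 ≤ |t - b| := abs_nonneg _
  have h1 : |t - b| ^ α ≤ 2 := by
    rcases le_or_gt (|t - b|) 1 with hle | hgt
    · exact (Real.rpow_le_one h0 hle hα).trans (by norm_num)
    · calc |t - b| ^ α ≤ |t - b| ^ (1 : ℝ) := Real.rpow_le_rpow_of_exponent_le hgt.le hα1
        _ = |t - b| := Real.rpow_one _
        _ ≤ 2 := ht.le
  nlinarith [Real.rpow_nonneg h0 α]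

end Stretch

/-! ### The stretched test rectangle -/

section Image

variable {Φ : ℂ ≃ₜ ℂ} {b α : ℝ} (h : ∀ z : ℂ, Φ z = stretchFn b α z)
include h

/-- The stretched rectangle lies in the upper half-plane. -/
theorem image_bigRect_subset_upperHalfPlaneSet :
    Φ '' bigRect.carrier ⊆ upperHalfPlaneSet := by
  rintro _ ⟨z, hz, rfl⟩
  exact (Stretch.mem_upperHalfPlaneSet_iff h z).2 (bigRect_subset_upperHalfPlaneSet hz)

omit h in
/-- The stretched rectangle is open. -/
theorem isOpen_image_bigRect : IsOpen (Φ '' bigRect.carrier) := Φ.isOpenMap _ bigRect.isOpen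

omit h in
/-- The stretched rectangle is connected. -/
theorem isPreconnected_image_bigRect : IsPreconnected (Φ '' bigRect.carrier) :=
  (bigRect.isConnected.image _ Φ.continuous.continuousOn).isPreconnected

omit h in
/-- `bigRect` is convex. -/
theorem convex_bigRect : Convex ℝ bigRect.carrier := by
  have hc : bigRect.carrier = ({z : ℂ | -10 < z.re} ∩ {z : ℂ | z.re < 10}) ∩
      ({z : ℂ | 0 < z.im} ∩ {z : ℂ | z.im < 20}) := by
    ext w; simp only [mem_bigRect, mem_inter_iff, mem_setOf_eq]
  rw [hc]
  exact ((convex_halfSpace_re_gt _).inter (convex_halfSpace_re_lt _)).inter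
    ((convex_halfSpace_im_gt _).inter (convex_halfSpace_im_lt _))

omit h in
/-- The stretched rectangle has the square-root property (it is homeomorphic to a convex set, hence
simply connected). -/
theorem hasSqrt_image_bigRect : HasSqrt (Φ '' bigRect.carrier) := by
  have hne : bigRect.carrier.Nonempty := bigRect.nonempty
  have : ContractibleSpace bigRect.carrier := convex_bigRect.contractibleSpace hne
  have : ContractibleSpace (Φ '' bigRect.carrier) := (Φ.image bigRect.carrier).symm.contractibleSpace
  have hsc : IsSimplyConnected (Φ '' bigRect.carrier) := by
    change SimplyConnectedSpace (Φ '' bigRect.carrier)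
    infer_instance
  exact hsc.hasSqrt isOpen_image_bigRect

/-- For centre `b` with `|b| ≤ 1` and `Φ 1 = 1`: the half-disc `B(1, 8) ∩ ℍ` lies in the stretched
rectangle (points of `ℍ` with `|Φ⁻¹ w - b| < 9` lie in `bigRect`). -/
theorem ball_inter_subset_image_bigRect (hα : 0 ≤ α) (hb : b ∈ Icc (0 : ℝ) 1) :
    ball (1 : ℂ) 8 ∩ upperHalfPlaneSet ⊆ Φ '' bigRect.carrier := by
  rintro w ⟨hw, hwH⟩
  refine ⟨Φ.symm w, ?_, Φ.apply_symm_apply w⟩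
  set z := Φ.symm w with hz
  have hΦz : Φ z = w := Φ.apply_symm_apply w
  have hzH : z ∈ upperHalfPlaneSet := by
    rw [← Stretch.mem_upperHalfPlaneSet_iff h z, hΦz]; exact hwH
  have hb' : |b| ≤ 1 := abs_le.2 ⟨by linarith [hb.1], hb.2⟩
  -- `|z - b|^{1+α} = |w - b| < 9`, hence `|z - b| < 9`
  have hwb : ‖w - b‖ < 9 := by
    calc ‖w - b‖ ≤ ‖w - 1‖ + ‖(1 : ℂ) - b‖ := norm_sub_le_norm_sub_add_norm_sub _ _ _
      _ < 8 + 1 := by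
        apply add_lt_add_of_lt_of_le (mem_ball_iff_norm.1 hw)
        rw [← ofReal_one, ← ofReal_sub, norm_real, Real.norm_eq_abs]
        rw [abs_le]; constructor <;> linarith [hb.1, hb.2]
      _ = 9 := by norm_num
  have hzb : ‖z - (b : ℂ)‖ < 9 := by
    by_contra hge
    push Not at hge
    have h1 : (9 : ℝ) ≤ ‖z - (b : ℂ)‖ ^ (1 + α) := by
      calc (9 : ℝ) ≤ ‖z - (b : ℂ)‖ := hge
        _ = ‖z - (b : ℂ)‖ ^ (1 : ℝ) := (Real.rpow_one _).symm
        _ ≤ ‖z - (b : ℂ)‖ ^ (1 + α) :=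
          Real.rpow_le_rpow_of_exponent_le (by linarith) (by linarith)
    rw [← Stretch.norm_sub h hα z, hΦz] at h1
    linarith
  exact mem_bigRect_of_norm_sub_lt hb' hzb hzH

end Image

end Summit.CriticalPhenomena.CardyFormulaZ2.Theorems.StretchedPullback
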